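import Summits.ValiantsHypothesis.ValiantsHypothesis.Theses.KPlusLogSqLawOctave
import Summits.ValiantsHypothesis.ValiantsHypothesis.Theorems.KPlusLogSqLawOctaveGlueCoherence
import Summits.ValiantsHypothesis.ValiantsHypothesis.Theorems.KPlusLogSqLawOctaveScalesClusters
import Summits.ValiantsHypothesis.ValiantsHypothesis.Theorems.KPlusLogSqLawOctaveRootNearBreakpoint
import Summits.ValiantsHypothesis.ValiantsHypothesis.Theorems.KPlusLogSqLawTropicalBPadding
import Summits.ValiantsHypothesis.ValiantsHypothesis.Theorems.KPlusLogSqLawOctaveReducedForm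
import Summits.ValiantsHypothesis.ValiantsHypothesis.Theorems.KPlusLogSqLawOctaveNormEra
import Summits.ValiantsHypothesis.ValiantsHypothesis.Theorems.KPlusLogSqLawOctaveCondPerturb

/-!
# Crux `WeakLifting` (stmt-ValiantsHypothesis-19561) · octave door `OctaveWeakLifting` (Ω-W, stmt-24457) — LINE «conditioning» (lens = control)

Ideator seat val-idea-1 (g3), D-0145 line proposal; director-valiant b50 KEY: «lens=control on stmt-19561: next line = a
controlling quantity for lifting depth».  HONEST FRAMING: nothing here proves `OctaveWeakLifting`, `WeakLifting`, `TropicalB`,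
Conjecture B or VP ≠ VNP.  v4 (2026-08-28): the rungs R0 · R1 · R2 are LANDED THEOREMS (`Theorems/KPlusLogSqLawOctave{ReducedForm,NormEra,CondPerturb}.lean`, cited by name); the ONLY
remaining sorry is the law stub K1 `stub_octaveStability`; everything else is kernel-checked composition, including
`octaveStability_iff_octaveWeakLifting : K1 ↔ Ω-W` (critic #22's trivial converse + the proved rungs) — so K1 is the door RE-TYPED, not a
weaker law (critic verdict #22: PASS-WITH-PRICE, R1 = structure, K1 = 0 provers).  VP ≠ VNP is not moved by a law candidate.

THE CONTROLLING QUANTITY.  For a real lacunary pencil `F = Σ_l X^{d_l} S_l` the (sup-norm) LOG-CONDITION of its letters,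
`Q(F) = max_l ⌈log₂ (‖S_l‖ · ‖S_l⁻¹‖)⌉` (certificate form `CondLE (S l) W`), is the currency in which root OCTAVES are paid:

* R1 `NormEraBound` (RUNG — LANDED: `Octave.normEra_octaveBound`, `Theorems/KPlusLogSqLawOctaveNormEra.lean`; evidence #43 on
  stmt-19561; planner seats cannot write Theorems/, a prover lands it `--supports 19561 --as helper`; generalised Pellet / tropical-scaling exclusion annuli of numerical linear algebra —
  Bini–Noferini–Sharify 2013, Noferini–Sharify–Tisseur 2015, Gaubert–Sharify 2009 — counted in dyadic octaves): with NO tropical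
  hypothesis and NO symmetry, `octaveCount (det F) ≤ (2(W + ⌊log₂ K⌋ + 1) + 2)·K²` whenever every letter is `2^W`-conditioned and the
  exponents are distinct: a root `x` forces `F(x) v = 0`, the norm-dominant letter `l*` at scale `θ = log₂|x|` then satisfies
  `2^{-W}·(top line) ≤ (K−1)·(runner-up line)`, so `θ` is within `W + log₂ K` of a breakpoint of the K-line NORM ENVELOPE
  `θ ↦ max_l (log₂ b_l + d_l θ)` (`envelopeGap`), and `cellCount_proof` counts octaves.  Tight up to constants on K = 2 staircases
  (Ω = m needs Q ≈ m).  It is gauge-covariant through `pencilDet_conj` (p594442): Q may be minimised over `(G S_l H)_l`.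
* R2 `ConditionedPerturbation` (RUNG — LANDED: `Octave.conditionedPerturbation`, `Theorems/KPlusLogSqLawOctaveCondPerturb.lean`):
  every nonzero symmetric letter tuple has a symmetric perturbation of entrywise relative size `2^{-P}` whose letters are
  `2^{m(P + log₂ m + 8)}`-conditioned and whose pencil determinant is not identically zero (the `m`-th forward difference of the monic
  `ε ↦ det(T + ε•1)` on the grid `{0,h,…,mh}` is `m! h^m` (`Polynomial.fwdDiff_iter_degree_eq_factorial`) ⇒ a grid point with
  `|det| ≥ m! h^m/2^m`; adjugate identity ⇒ norm certificate; top-exponent domination at a large point ⇒ `pencilDet ≠ 0`).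
* K1 `OctaveStability` (THE LAW STUB, crux-strength): under the TropRow hypothesis of Ω-W at `(m,K,n)`, perturbing the letters of a
  symmetric pencil at relative precision `2^{-2^{C(K+⌊log₂m⌋²)}(n+1)}` keeps all but `2^{C(K+⌊log₂m⌋²)}(n+1)` root octaves up to the
  boundary-drift factor 3.  Equivalently: ill-conditioning beyond doubly-exponential-in-format precision creates no octaves —
  the DICHOTOMY «Q(F) ≤ budget ⇒ R1; Q(F) > budget ⇒ perturb (K1) and R1».  The tropical count `n` enters ONLY as a precision.
* R0 `ReducedForm` (plumbing — LANDED: `Octave.reducedForm`, `Theorems/KPlusLogSqLawOctaveReducedForm.lean`, evidence #49): merge equal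
  exponents, drop zero letters (same determinant, injective exponents, entry scales).

Composition (PROVED below): `R0 → R1 → R2 → K1 → Octave.OctaveWeakLifting` (`OctaveWeakLifting_of`), the route item
`Theses.KPlusLogSqLawOctave.OctaveWeakLifting` BY NAME (`routeCrux_of`), and `TropicalB → … → VP ≠ VNP` (`valiant_of`) through the landed
glue `valiant_of_tropicalB_of_octaveWeakLifting`.  SAME-WALL honesty: given R0–R2, K1 ⟺ Ω-W (Ω-W ⇒ K1 trivially); the line does not
weaken the wall, it moves it onto a perturbation-stability statement where smoothed-analysis / discriminant-distance tools apply and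
where the instrument is the robustness margin `log₂(per|F|(a)/|det F(a)|)` at the census alternation points (card §Instrument).
-/

set_option linter.dupNamespace false
set_option autoImplicit false

/-! ## RUNGS R0 · R1 · R2 — LANDED in the tree (2026-08-28 ≈03:02Z, director b69 turnkey): `Theorems/KPlusLogSqLawOctaveReducedForm.lean`
(`Octave.reducedForm`) · `Theorems/KPlusLogSqLawOctaveNormEra.lean` (`Octave.normEra_octaveBound`) · `Theorems/KPlusLogSqLawOctaveCondPerturb.lean`
(`Octave.conditionedPerturbation`); the stubs below cite them BY NAME (v4; v2/v3 carried in-file copies under `…Conditioning.Rungs`). -/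


namespace Summit.ValiantsHypothesis.ValiantsHypothesis.Cruxes.WeakLifting.Conditioning

open Polynomial Finset Matrix
open scoped BigOperators
open Summit.ValiantsHypothesis.ValiantsHypothesis.Theorems.KPlusLogSqLaw.Octave (pencilDet octaveCount OctaveRootLawAt OctaveWeakLifting)
open Summit.ValiantsHypothesis.ValiantsHypothesis.Theorems.LacunarySymmetroidMatrixDescartes.TropicalCensus (TropRootLawAt)
open Summit.ValiantsHypothesis.ValiantsHypothesis.Theorems.KPlusLogSqLaw (tropRootLawAt_of_le_classes)
open Summit.ValiantsHypothesis.ValiantsHypothesis.Theses.KPlusLogSqLaw (TropicalB)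

/-! ## Vocabulary (two certificates, no new objects) -/

/-- `ρ` is the entry scale of `S`: all entries have modulus `≤ ρ` and some entry has modulus `≥ ρ` (so `ρ = max |S i j|`). -/
def IsEntryScale {m : ℕ} (S : Matrix (Fin m) (Fin m) ℝ) (ρ : ℝ) : Prop :=
  (∀ i j, |S i j| ≤ ρ) ∧ ∃ i j, ρ ≤ |S i j|

/-- **conditioning certificate** (the controlling quantity): `S` is `2^W`-conditioned for the sup norm on `Fin m → ℝ` —
a lower weight `a > 0` with `a‖v‖ ≤ ‖S v‖ ≤ 2^W a ‖v‖`.  (`W ≥ log₂ κ_∞(S)`; any invertible `S` has one for some `W`.) -/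
def CondLE {m : ℕ} (S : Matrix (Fin m) (Fin m) ℝ) (W : ℕ) : Prop :=
  ∃ a : ℝ, 0 < a ∧ (∀ v : Fin m → ℝ, a * ‖v‖ ≤ ‖S *ᵥ v‖) ∧ (∀ v : Fin m → ℝ, ‖S *ᵥ v‖ ≤ 2 ^ W * a * ‖v‖)

/-! ## The four obligations (Props).  R0 · R1 · R2 are closed by landed Theorems decls; `stub_octaveStability` is the ONLY sorry. -/

/-- **R0 · reduced form** (plumbing, S/M): merging letters with equal exponents and dropping zero letters does not change the pencil
determinant; the result has injective exponents, nonzero symmetric letters with entry scales, and at most `K` letters. [folklore] -/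
def ReducedForm : Prop :=
  ∀ (m K : ℕ) (d : Fin K → ℕ) (S : Fin K → Matrix (Fin m) (Fin m) ℝ), (∀ l, (S l).IsSymm) →
    ∃ (K' : ℕ) (_ : K' ≤ K) (d' : Fin K' → ℕ) (S' : Fin K' → Matrix (Fin m) (Fin m) ℝ) (ρ : Fin K' → ℝ),
      Function.Injective d' ∧ (∀ l, (S' l).IsSymm) ∧ (∀ l, 0 < ρ l) ∧ (∀ l, IsEntryScale (S' l) (ρ l)) ∧
      pencilDet d' S' = pencilDet d S

/-- **R1 · norm-era bound** (RUNG; generalised-Pellet exclusion counted in octaves; NO tropical hypothesis, NO symmetry):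
distinct exponents and `2^W`-conditioned letters ⇒ the nonzero real roots of `det Σ X^{d_l} S_l` occupy at most
`(2(W + ⌊log₂ K⌋ + 1) + 2)·K²` dyadic octaves (sharp count replaces `K²` by the `≤ K − 1` vertices of the norm envelope). [this line] -/
def NormEraBound : Prop :=
  ∀ (m K W : ℕ) (d : Fin K → ℕ) (S : Fin K → Matrix (Fin m) (Fin m) ℝ), Function.Injective d → (∀ l, CondLE (S l) W) →
    octaveCount (pencilDet d S) ≤ (2 * (W + Nat.log 2 K + 1) + 2) * (K * K)

/-- **R2 · conditioned perturbation** (RUNG, M): a symmetric letter tuple with entry scales `ρ_l` has a symmetric perturbation of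
entrywise size `≤ 2^{-P} ρ_l` whose letters are `2^{m(P + ⌊log₂ m⌋ + 8)}`-conditioned and whose pencil determinant is nonzero
(`S_l + ε_l ρ_l I` with `ε_l` on a grid of `m + 1` points: the monic `det` takes a value `≥ (step/2)^m m!`; adjugate bound; leading
coefficient `det S'_{argmax d} ≠ 0` for injective `d`). [folklore] -/
def ConditionedPerturbation : Prop :=
  ∀ (m K P : ℕ) (d : Fin K → ℕ) (S : Fin K → Matrix (Fin m) (Fin m) ℝ) (ρ : Fin K → ℝ), 0 < K → Function.Injective d →
    (∀ l, (S l).IsSymm) → (∀ l, 0 < ρ l) → (∀ l, IsEntryScale (S l) (ρ l)) →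
    ∃ S' : Fin K → Matrix (Fin m) (Fin m) ℝ, (∀ l, (S' l).IsSymm) ∧ (∀ l i j, (2 : ℝ) ^ P * |S' l i j - S l i j| ≤ ρ l) ∧
      (∀ l, CondLE (S' l) (m * (P + Nat.log 2 m + 8))) ∧ pencilDet d S' ≠ 0

/-- **K1 · octave stability** (THE LAW STUB; crux-strength, Ω-W-equivalent given R0–R2): under the TropRow hypothesis of Ω-W at
`(m, K, n)`, every symmetric perturbation of a reduced symmetric `(m,K)` pencil at entrywise relative precision
`2^{-2^{C(K+⌊log₂m⌋²)}(n+1)}` with nonzero determinant retains all but `2^{C(K+⌊log₂m⌋²)}(n+1)` root octaves, up to the factor `3`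
(one octave of drift each side).  Why it might fail: octaves whose sign changes are all `2^{-P}`-deep (even pockets: a near-tangential
pair of roots alone in its octave) are destroyed by perturbation; the claim is that TropRow bounds the number of such octaves —
nothing located forbids a family of budget-many isolated near-double roots, but that family would already violate Ω-W. [this line] -/
def OctaveStability : Prop :=
  ∃ C : ℕ, ∀ (m K n : ℕ), TropRootLawAt m K n →
    ∀ (d : Fin K → ℕ) (S S' : Fin K → Matrix (Fin m) (Fin m) ℝ) (ρ : Fin K → ℝ), Function.Injective d →
      (∀ l, (S l).IsSymm) → (∀ l, (S' l).IsSymm) → (∀ l, 0 < ρ l) → (∀ l, IsEntryScale (S l) (ρ l)) →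
      (∀ l i j, (2 : ℝ) ^ (2 ^ (C * (K + Nat.log 2 m ^ 2)) * (n + 1)) * |S' l i j - S l i j| ≤ ρ l) →
      pencilDet d S' ≠ 0 →
      octaveCount (pencilDet d S) ≤ 2 ^ (C * (K + Nat.log 2 m ^ 2)) * (n + 1) + 3 * octaveCount (pencilDet d S')

/-! ## Registered stubs (R0 · R1 · R2 closed BY NAME by the landed Theorems decls; K1 open — the only sorry of the file) -/

/-- stub R0 — CLOSED by the landed `Octave.reducedForm` (Theorems/KPlusLogSqLawOctaveReducedForm.lean). -/
theorem stub_reducedForm : ReducedForm :=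
  fun m K d S hS => Summit.ValiantsHypothesis.ValiantsHypothesis.Theorems.KPlusLogSqLaw.Octave.reducedForm m K d S hS

/-- stub R1 — CLOSED by the landed `Octave.normEra_octaveBound` (Theorems/KPlusLogSqLawOctaveNormEra.lean). -/
theorem stub_normEraBound : NormEraBound :=
  fun m K W d S hd hc => Summit.ValiantsHypothesis.ValiantsHypothesis.Theorems.KPlusLogSqLaw.Octave.normEra_octaveBound m K W d S hd hc

/-- stub R2 — CLOSED by the landed `Octave.conditionedPerturbation` (Theorems/KPlusLogSqLawOctaveCondPerturb.lean). -/
theorem stub_conditionedPerturbation : ConditionedPerturbation :=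
  fun m K P d S ρ hK hd hS hρ hsc => Summit.ValiantsHypothesis.ValiantsHypothesis.Theorems.KPlusLogSqLaw.Octave.conditionedPerturbation m K P d S ρ hK hd hS hρ hsc

/-- stub K1 (XL; the law). -/
theorem stub_octaveStability : OctaveStability := by
  sorry

/-! ## Kernel-checked composition -/

/-- the octave count of the zero polynomial and of constants is `0`. [folklore] -/
theorem octaveCount_C (c : ℝ) : octaveCount (Polynomial.C c) = 0 := by
  simp [Summit.ValiantsHypothesis.ValiantsHypothesis.Theorems.KPlusLogSqLaw.Octave.octaveCount]

/-- with no letters the pencil determinant is a constant (`det 0`). [folklore] -/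
theorem pencilDet_fin_zero {m : ℕ} (d : Fin 0 → ℕ) (S : Fin 0 → Matrix (Fin m) (Fin m) ℝ) :
    ∃ c : ℝ, pencilDet d S = Polynomial.C c := by
  unfold Summit.ValiantsHypothesis.ValiantsHypothesis.Theorems.KPlusLogSqLaw.Octave.pencilDet
  rw [Finset.univ_eq_empty, Finset.sum_empty]
  rcases Nat.eq_zero_or_pos m with hm | hm
  · subst hm
    exact ⟨1, by rw [Matrix.det_isEmpty, map_one]⟩
  · haveI : Nonempty (Fin m) := ⟨⟨0, hm⟩⟩
    exact ⟨0, by rw [Matrix.det_zero, map_zero]⟩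

/-- the budget arithmetic: `P + 3·(2(m(P + L + 8) + log₂K' + 1) + 2)·K'² ≤ 2^{(C+12)(K+L²)}(n+1)` for `1 ≤ K' ≤ K`,
`P = 2^{C(K'+L²)}(n+1)`, `L = ⌊log₂ m⌋`. [folklore] -/
theorem inner_le (m L K Q : ℕ) (hQ : 1 ≤ Q) :
    2 * (m * (Q + L + 8) + K + 1) + 2 ≤ Q * (2 * (m * (L + 9)) + 2 * K + 4) := by
  obtain ⟨q, rfl⟩ := Nat.exists_eq_add_of_le hQ
  nlinarith [Nat.zero_le (q * m * L), Nat.zero_le (q * m), Nat.zero_le (q * K), Nat.zero_le q]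

theorem budget_arith (C m K K' n : ℕ) (hK' : K' ≤ K) (hK0 : 0 < K') :
    2 ^ (C * (K' + Nat.log 2 m ^ 2)) * (n + 1) +
        3 * ((2 * (m * (2 ^ (C * (K' + Nat.log 2 m ^ 2)) * (n + 1) + Nat.log 2 m + 8) + Nat.log 2 K' + 1) + 2) * (K' * K')) ≤
      2 ^ ((C + 12) * (K + Nat.log 2 m ^ 2)) * (n + 1) := by
  set L := Nat.log 2 m with hL
  set Q := 2 ^ (C * (K + L ^ 2)) * (n + 1) with hQ
  set P := 2 ^ (C * (K' + L ^ 2)) * (n + 1) with hP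
  have hPQ : P ≤ Q :=
    Nat.mul_le_mul_right _ (Nat.pow_le_pow_right (by norm_num) (Nat.mul_le_mul_left _ (by omega)))
  have hQ1 : 1 ≤ Q := by
    have : 1 ≤ 2 ^ (C * (K + L ^ 2)) := Nat.one_le_two_pow
    rw [hQ]; nlinarith
  have hm : m < 2 ^ (L + 1) := Nat.lt_pow_succ_log_self one_lt_two m
  have hKK : Nat.log 2 K' ≤ K := (Nat.log_le_self 2 K').trans hK'
  have hxK : K < 2 ^ K := Nat.lt_two_pow_self
  set x := 2 ^ K with hx
  set y := 2 ^ L with hy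
  have hy1 : 1 ≤ y := Nat.one_le_two_pow
  have hx1 : 1 ≤ x := Nat.one_le_two_pow
  have hm' : m ≤ 2 * y := by rw [hy]; rw [pow_succ] at hm; omega
  have hLy : L < y := by rw [hy]; exact Nat.lt_two_pow_self
  -- polynomial bound on the bracket
  have hbr : 1 + 3 * ((2 * (m * (L + 9)) + 2 * K + 4) * (K' * K')) ≤ 2 ^ 9 * (x * x * x) * (y * y) := by
    have hK'x : K' ≤ x := by omega
    have h1 : K' * K' ≤ x * x := Nat.mul_le_mul hK'x hK'x
    have h2 : m * (L + 9) ≤ 2 * y * (10 * y) := Nat.mul_le_mul hm' (by omega)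
    have e1 : 2 * (m * (L + 9)) + 2 * K + 4 ≤ 40 * (y * y) + 6 * x := by nlinarith [h2]
    have e2 : (2 * (m * (L + 9)) + 2 * K + 4) * (K' * K') ≤ (40 * (y * y) + 6 * x) * (x * x) :=
      Nat.mul_le_mul e1 h1
    have p1 : 1 ≤ x * x * x * (y * y) := by
      have := Nat.mul_le_mul (Nat.mul_le_mul (Nat.mul_le_mul hx1 hx1) hx1) (Nat.mul_le_mul hy1 hy1); simpa using this
    have p2 : x * x * (y * y) ≤ x * x * x * (y * y) := by
      have := Nat.mul_le_mul_right (y * y) (Nat.mul_le_mul_left (x * x) hx1); simpa [mul_comm, mul_assoc, mul_left_comm] using this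
    have p3 : x * x * x ≤ x * x * x * (y * y) := by
      have := Nat.mul_le_mul_left (x * x * x) (Nat.mul_le_mul hy1 hy1); simpa using this
    nlinarith [e2, p1, p2, p3]
  -- exponent bookkeeping
  have hpow : 2 ^ 9 * (x * x * x) * (y * y) * Q ≤ 2 ^ ((C + 12) * (K + L ^ 2)) * (n + 1) := by
    have hL2 : L ≤ L ^ 2 := by rw [sq]; exact Nat.le_mul_self L
    have hK1 : 1 ≤ K := hK0.trans_le hK'
    have : 2 ^ 9 * (x * x * x) * (y * y) * 2 ^ (C * (K + L ^ 2)) ≤ 2 ^ ((C + 12) * (K + L ^ 2)) := by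
      rw [hx, hy, ← pow_add, ← pow_add, ← pow_add, ← pow_add, ← pow_add, ← pow_add]
      exact Nat.pow_le_pow_right (by norm_num) (by nlinarith)
    calc 2 ^ 9 * (x * x * x) * (y * y) * Q = 2 ^ 9 * (x * x * x) * (y * y) * 2 ^ (C * (K + L ^ 2)) * (n + 1) := by rw [hQ]; ring
      _ ≤ 2 ^ ((C + 12) * (K + L ^ 2)) * (n + 1) := Nat.mul_le_mul_right _ this
  calc P + 3 * ((2 * (m * (P + L + 8) + Nat.log 2 K' + 1) + 2) * (K' * K'))
      ≤ Q + 3 * ((2 * (m * (Q + L + 8) + K + 1) + 2) * (K' * K')) := by gcongr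
    _ ≤ Q + 3 * ((Q * (2 * (m * (L + 9)) + 2 * K + 4)) * (K' * K')) := by
        have := inner_le m L K Q hQ1
        gcongr
    _ = Q * (1 + 3 * ((2 * (m * (L + 9)) + 2 * K + 4) * (K' * K'))) := by ring
    _ ≤ Q * (2 ^ 9 * (x * x * x) * (y * y)) := Nat.mul_le_mul_left _ hbr
    _ = 2 ^ 9 * (x * x * x) * (y * y) * Q := by ring
    _ ≤ 2 ^ ((C + 12) * (K + L ^ 2)) * (n + 1) := hpow

/-- **THE COMPOSITION (kernel-checked): R0 → R1 → R2 → K1 → Ω-W** (the landed `Octave.OctaveWeakLifting`). [this line] -/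
theorem OctaveWeakLifting_of (h0 : ReducedForm) (h1 : NormEraBound) (h2 : ConditionedPerturbation) (h3 : OctaveStability) :
    OctaveWeakLifting := by
  obtain ⟨C, hC⟩ := h3
  refine ⟨C + 12, fun m K n hT d S hS => ?_⟩
  show octaveCount (pencilDet d S) ≤ _
  obtain ⟨K', hK', d', S', ρ, hd', hS', hρ, hsc, hdet⟩ := h0 m K d S hS
  rw [← hdet]
  have hT' : TropRootLawAt m K' n := tropRootLawAt_of_le_classes hK' hT
  rcases Nat.eq_zero_or_pos K' with hK0 | hK0
  · subst hK0
    obtain ⟨c, hc⟩ := pencilDet_fin_zero d' S'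
    rw [hc, octaveCount_C]
    exact Nat.zero_le _
  · set P := 2 ^ (C * (K' + Nat.log 2 m ^ 2)) * (n + 1) with hP
    obtain ⟨S'', hS''symm, hpert, hcond, hne⟩ := h2 m K' P d' S' ρ hK0 hd' hS' hρ hsc
    have hK1 := hC m K' n hT' d' S' S'' ρ hd' hS' hS''symm hρ hsc hpert hne
    have hR1 := h1 m K' (m * (P + Nat.log 2 m + 8)) d' S'' hd' hcond
    calc octaveCount (pencilDet d' S')
        ≤ P + 3 * octaveCount (pencilDet d' S'') := hK1
      _ ≤ P + 3 * ((2 * (m * (P + Nat.log 2 m + 8) + Nat.log 2 K' + 1) + 2) * (K' * K')) := by gcongr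
      _ ≤ 2 ^ ((C + 12) * (K + Nat.log 2 m ^ 2)) * (n + 1) := budget_arith C m K K' n hK' hK0

/-- the route item (stmt-ValiantsHypothesis-24457) BY NAME. -/
theorem routeCrux_of (h0 : ReducedForm) (h1 : NormEraBound) (h2 : ConditionedPerturbation) (h3 : OctaveStability) :
    Summit.ValiantsHypothesis.ValiantsHypothesis.Theses.KPlusLogSqLawOctave.OctaveWeakLifting :=
  OctaveWeakLifting_of h0 h1 h2 h3

/-- **Ω-W ⟸ K1, SORRY-FREE** (v2): with the rungs R0 · R1 · R2 proved above, the octave door follows from the law stub alone. [this line] -/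
theorem octaveWeakLifting_of_octaveStability (hK1 : OctaveStability) : OctaveWeakLifting :=
  OctaveWeakLifting_of stub_reducedForm stub_normEraBound stub_conditionedPerturbation hK1

/-- the route item BY NAME from K1 alone (sorry-free). -/
theorem routeCrux_of_octaveStability (hK1 : OctaveStability) :
    Summit.ValiantsHypothesis.ValiantsHypothesis.Theses.KPlusLogSqLawOctave.OctaveWeakLifting :=
  octaveWeakLifting_of_octaveStability hK1

/-- **VP ≠ VNP ⟸ TropicalB + K1, SORRY-FREE** (landed glue `valiant_of_tropicalB_of_octaveWeakLifting`). -/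
theorem valiant_of_tropicalB_of_octaveStability (hT : TropicalB) (hK1 : OctaveStability) : _root_.ValiantsHypothesis :=
  Summit.ValiantsHypothesis.ValiantsHypothesis.Theorems.KPlusLogSqLaw.Octave.valiant_of_tropicalB_of_octaveWeakLifting hT
    (octaveWeakLifting_of_octaveStability hK1)

/-- **the converse is trivial and `S'`-blind** (critic val-idea-crit-2, VERDICT #22): the door implies K1 with the same constant, so as
STATEMENTS K1 ≡ Ω-W — K1 is the door re-typed in perturbation form, not a weaker law (hence «0 provers on K1»; the line's content is the
rungs).  [critic #22, kernel-certified here] -/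
theorem octaveStability_of_octaveWeakLifting (h : OctaveWeakLifting) : OctaveStability := by
  obtain ⟨C, hC⟩ := h
  refine ⟨C, fun m K n hT d S S' ρ _ hS _ _ _ _ _ => ?_⟩
  exact Nat.le_add_right_of_le (hC m K n hT d S hS)

/-- **K1 ⟺ Ω-W, SORRY-FREE** (⇒ through the proved rungs R0 · R1 · R2 with `C ↦ C + 12`; ⇐ trivial). [this line + critic #22] -/
theorem octaveStability_iff_octaveWeakLifting : OctaveStability ↔ OctaveWeakLifting :=
  ⟨octaveWeakLifting_of_octaveStability, octaveStability_of_octaveWeakLifting⟩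

/-- with the stub: Ω-W (nothing is claimed proved — the sorried K1 stub carries all content). -/
theorem OctaveWeakLifting_of_stubs : OctaveWeakLifting :=
  octaveWeakLifting_of_octaveStability stub_octaveStability

/-- **VP ≠ VNP from TropicalB and the four obligations** (landed glue `valiant_of_tropicalB_of_octaveWeakLifting`). -/
theorem valiant_of (hT : TropicalB) (h0 : ReducedForm) (h1 : NormEraBound) (h2 : ConditionedPerturbation) (h3 : OctaveStability) :
    _root_.ValiantsHypothesis :=
  Summit.ValiantsHypothesis.ValiantsHypothesis.Theorems.KPlusLogSqLaw.Octave.valiant_of_tropicalB_of_octaveWeakLifting hT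
    (OctaveWeakLifting_of h0 h1 h2 h3)

end Summit.ValiantsHypothesis.ValiantsHypothesis.Cruxes.WeakLifting.Conditioning
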